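import Mathlib
import Summits.QuantumFields.YangMills.Theses.MirrorModularBoosts
import Literature.Analysis.Complex.HolomorphicParametricIntegral
import Literature.MathematicalPhysics.QuantumFieldTheory.OSReconstructionNoE1Proofs

/-!
# First-gap corollary for `stub_coneChain_dense` (drefute gen 2, evidence)

Crux `MirrorModularBoosts.PlanarSpectralCone` (stmt-QuantumFields-9664), line `two-mirror-lightcone-slots`,
stub `stub_coneChain_dense`. The ENGINE-FREE part of the density argument (DrefuteSurvivedG2.md §C.4 step 8):
a vector orthogonal to all cone-chain field vectors is orthogonal to `Ψ_F` for every time-ordered `F` which is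
INTERNALLY cone-ordered (`|xⱼ¹ − xᵢ¹| < xⱼ⁰ − xᵢ⁰` on its support) with bounded first spatial coordinate
(`|xᵢ¹| ≤ D`). Proof: `e^{-sH}Ψ_F = Ψ_{F_{s e₀}}` is a cone chain for `s > max D 0`; `s ↦ ⟪χ, e^{-sH}Ψ_F⟫` is the
restriction of a function holomorphic on `Re s > 0` (the landed `stub_complexTimeSlot` at `a = 0`), vanishing on
`(max D 0, ∞)`, hence on `(0, ∞)` (identity theorem); strong continuity at `s = 0`.
So the engine / Gram-vector machinery is needed exactly to remove the inter-point condition (inner gaps).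
-/

noncomputable section

namespace DrefuteG2

open MeasureTheory Complex Set Filter Topology
open scoped InnerProductSpace ComplexConjugate
open Literature.MathematicalPhysics.QuantumLattice Literature.MathematicalPhysics.AQFT
  Literature.MathematicalPhysics.QuantumFieldTheory
local notation "E4" => EuclideanSpace ℝ (Fin 4)

/-! ## Complex-time matrix elements (trimmed copy, `a = 0`, of the lead's landed
`MirrorModularBoostsPlanarSpectralConeComplexTimeSlot` helpers — p72306; copied here only because that module is
not yet built on the farm at check time) -/
namespace CTS

theorem inner_map_polarization_right {V : Type*} [NormedAddCommGroup V] [InnerProductSpace ℂ V]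
    (A : V →ₗ[ℂ] V) (x y : V) :
    ⟪x, A y⟫_ℂ =
      (⟪x + y, A (x + y)⟫_ℂ - ⟪x - y, A (x - y)⟫_ℂ - I * ⟪x + I • y, A (x + I • y)⟫_ℂ +
        I * ⟪x - I • y, A (x - I • y)⟫_ℂ) / 4 := by
  simp only [map_add, map_sub, map_smul, inner_add_left, inner_add_right, inner_sub_left,
    inner_sub_right, inner_smul_left, inner_smul_right, Complex.conj_I]
  linear_combination ((⟪x, A y⟫_ℂ - ⟪y, A x⟫_ℂ) / 2) * Complex.I_sq

theorem norm_lKernel (τ : ℂ) (p : E4) :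
    ‖cexp (-(τ * ((p 0 : ℝ) : ℂ)))‖ = Real.exp (-(τ.re * p 0)) := by
  rw [Complex.norm_exp]
  congr 1
  simp

theorem norm_lKernel_le_one {τ : ℂ} (hτ : 0 ≤ τ.re) {p : E4} (hp : 0 ≤ p 0) :
    ‖cexp (-(τ * ((p 0 : ℝ) : ℂ)))‖ ≤ 1 := by
  rw [norm_lKernel, Real.exp_le_one_iff, neg_nonpos]
  exact mul_nonneg hτ hp

theorem re_pos_of_mem_ball {τ₀ τ : ℂ} (hτ : τ ∈ Metric.ball τ₀ τ₀.re) : 0 < τ.re := by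
  rw [Metric.mem_ball, dist_eq_norm] at hτ
  have h1 := abs_re_le_norm (τ - τ₀)
  rw [Complex.sub_re] at h1
  have h2 := (abs_lt.1 (h1.trans_lt hτ)).1
  linarith

/-- Laplace transform of a finite measure on `{p₀ ≥ 0}`: holomorphic on `Re τ > 0`, with the real points in the
normal form of `IsJointSpectralMeasure.inner_transfer`. -/
theorem exists_laplace (μ : Measure E4) [IsFiniteMeasure μ] (hE : μ {p | p 0 < 0} = 0) :
    ∃ g : ℂ → ℂ, DifferentiableOn ℂ g {τ : ℂ | 0 < τ.re} ∧
      ∀ x : ℝ, 0 < x → g x = ∫ p, cexp (((-(x * p 0) : ℝ) : ℂ)) ∂μ := by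
  have hae : ∀ᵐ p ∂μ, 0 ≤ p 0 := by
    rw [ae_iff]
    simpa only [not_le] using hE
  refine ⟨fun τ => ∫ p, cexp (-(τ * ((p 0 : ℝ) : ℂ))) ∂μ, ?_, fun x hx => ?_⟩
  · refine Literature.Analysis.Complex.differentiableOn_integral_of_dominated
      (fun τ _ => (by fun_prop : Continuous fun p : E4 => cexp (-(τ * ((p 0 : ℝ) : ℂ)))).aestronglyMeasurable)
      (Eventually.of_forall fun p =>
        (by fun_prop : Differentiable ℂ fun τ : ℂ => cexp (-(τ * ((p 0 : ℝ) : ℂ)))).differentiableOn)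
      fun τ₀ hτ₀ => ?_
    refine ⟨τ₀.re, hτ₀, fun τ hτ => re_pos_of_mem_ball hτ, fun _ => 1, integrable_const _, ?_⟩
    filter_upwards [hae] with p hp
    intro τ hτ
    exact norm_lKernel_le_one (re_pos_of_mem_ball hτ).le hp
  · show ∫ p, cexp (-((x : ℂ) * ((p 0 : ℝ) : ℂ))) ∂μ = _
    refine integral_congr_ae (ae_of_all _ fun p => ?_)
    push_cast
    ring_nf

/-- `x ↦ ⟪ψ, e^{-xH}ψ'⟫` is the restriction of a function holomorphic on the right half-plane. -/
theorem exists_holo_inner_transfer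
    {ι : Type} {T : LabelledSchwingerFamily ι E4} (h : OSReconstructionNoE1 T) (ψ ψ' : h.Hilbert) :
    ∃ g : ℂ → ℂ, DifferentiableOn ℂ g {τ : ℂ | 0 < τ.re} ∧
      ∀ x : ℝ, 0 < x → g x = ⟪ψ, h.transfer x ψ'⟫_ℂ := by
  obtain ⟨μ₁, hμ₁⟩ := OSReconstructionNoE1.exists_isJointSpectralMeasure_holds h (ψ + ψ')
  obtain ⟨μ₂, hμ₂⟩ := OSReconstructionNoE1.exists_isJointSpectralMeasure_holds h (ψ - ψ')
  obtain ⟨μ₃, hμ₃⟩ := OSReconstructionNoE1.exists_isJointSpectralMeasure_holds h (ψ + I • ψ')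
  obtain ⟨μ₄, hμ₄⟩ := OSReconstructionNoE1.exists_isJointSpectralMeasure_holds h (ψ - I • ψ')
  haveI := hμ₁.isFiniteMeasure
  haveI := hμ₂.isFiniteMeasure
  haveI := hμ₃.isFiniteMeasure
  haveI := hμ₄.isFiniteMeasure
  obtain ⟨g₁, hd₁, hr₁⟩ := exists_laplace μ₁ hμ₁.energy_nonneg
  obtain ⟨g₂, hd₂, hr₂⟩ := exists_laplace μ₂ hμ₂.energy_nonneg
  obtain ⟨g₃, hd₃, hr₃⟩ := exists_laplace μ₃ hμ₃.energy_nonneg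
  obtain ⟨g₄, hd₄, hr₄⟩ := exists_laplace μ₄ hμ₄.energy_nonneg
  refine ⟨fun τ => (g₁ τ - g₂ τ - I * g₃ τ + I * g₄ τ) / 4, ?_, fun x hx => ?_⟩
  · exact (((hd₁.sub hd₂).sub (hd₃.const_mul I)).add (hd₄.const_mul I)).div_const 4
  · show (g₁ x - g₂ x - I * g₃ x + I * g₄ x) / 4 = _
    rw [hr₁ x hx, hr₂ x hx, hr₃ x hx, hr₄ x hx,
      ← OSReconstructionNoE1.IsJointSpectralMeasure.inner_transfer h hμ₁ hx.le,
      ← OSReconstructionNoE1.IsJointSpectralMeasure.inner_transfer h hμ₂ hx.le,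
      ← OSReconstructionNoE1.IsJointSpectralMeasure.inner_transfer h hμ₃ hx.le,
      ← OSReconstructionNoE1.IsJointSpectralMeasure.inner_transfer h hμ₄ hx.le]
    exact (inner_map_polarization_right (h.transfer x : h.Hilbert →ₗ[ℂ] h.Hilbert) ψ ψ').symm

end CTS

/-- Time translation by `s > max D 0` turns an internally cone-ordered, `|x¹| ≤ D`-bounded time-ordered test
function into a cone chain. -/
theorem coneChain_translate_timeVec {m : ℕ} (F : SchwartzMap (Fin m → E4) ℂ) (hF : IsTimeOrdered F) (D : ℝ)
    (hFD : tsupport (F : (Fin m → E4) → ℂ) ⊆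
        {x | (∀ i, |x i 1| ≤ D) ∧ ∀ i j, i < j → |x j 1 - x i 1| < x j 0 - x i 0})
    {s : ℝ} (hs : max D 0 < s) :
    tsupport ((translateMulti (SchwingerFamily.timeVec s) F : SchwartzMap (Fin m → E4) ℂ) :
        (Fin m → E4) → ℂ) ⊆
      {x | (∀ i, |x i 1| < x i 0) ∧ ∀ i j, i < j → |x j 1 - x i 1| < x j 0 - x i 0} := by
  intro x hx
  have hx' := OSReconstructionNoE1.tsupport_translateMulti_subset (SchwingerFamily.timeVec s) F hx
  simp only [Set.mem_preimage] at hx'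
  obtain ⟨hD', hcone⟩ := hFD hx'
  have hpos := (hF hx').1
  have hDs : D < s := lt_of_le_of_lt (le_max_left _ _) hs
  refine ⟨fun i => ?_, fun i j hij => ?_⟩
  · have h1 := hD' i
    have h2 := hpos i
    simp only [PiLp.sub_apply, PiLp.single_apply] at h1 h2
    simp only [one_ne_zero, ↓reduceIte, sub_zero, ↓reduceIte] at h1 h2
    linarith [abs_nonneg (x i 1)]
  · have h3 := hcone i j hij
    simp only [PiLp.sub_apply, PiLp.single_apply] at h3
    simp only [one_ne_zero, ↓reduceIte, sub_zero] at h3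
    linarith

/-- **First-gap corollary.** In the e₀ reconstruction `h` of a one-species family `S`, a vector `χ` orthogonal to
the field vectors of all cone chains is orthogonal to `Ψ_F` for every time-ordered `F` that is internally
cone-ordered with `|xᵢ¹| ≤ D` on its support. -/
theorem inner_fieldVec_eq_zero_of_internallyConed
    (S : SchwingerFamily E4) (h : OSReconstructionNoE1 S.toLabelled) (χ : h.Hilbert)
    (hχ : ∀ (m : ℕ) (G : SchwartzMap (Fin m → E4) ℂ) (hG : IsTimeOrdered G),
      tsupport (G : (Fin m → E4) → ℂ) ⊆
        {x | (∀ i, |x i 1| < x i 0) ∧ ∀ i j, i < j → |x j 1 - x i 1| < x j 0 - x i 0} →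
      ⟪χ, h.fieldVec m (fun _ => ()) G hG⟫_ℂ = 0)
    {m : ℕ} (F : SchwartzMap (Fin m → E4) ℂ) (hF : IsTimeOrdered F) (D : ℝ)
    (hFD : tsupport (F : (Fin m → E4) → ℂ) ⊆
        {x | (∀ i, |x i 1| ≤ D) ∧ ∀ i j, i < j → |x j 1 - x i 1| < x j 0 - x i 0}) :
    ⟪χ, h.fieldVec m (fun _ => ()) F hF⟫_ℂ = 0 := by
  set ψF := h.fieldVec m (fun _ => ()) F hF with hψF
  -- Step 1: beyond `max D 0` the translated function is a cone chain
  have step1 : ∀ s : ℝ, max D 0 < s → ⟪χ, h.transfer s ψF⟫_ℂ = 0 := by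
    intro s hs
    have hs0 : 0 ≤ s := le_trans (le_max_right _ _) hs.le
    rw [hψF, h.transfer_fieldVec hs0]
    exact hχ m _ _ (coneChain_translate_timeVec F hF D hFD hs)
  -- Step 2: the holomorphic function (complex-time matrix element at `a = 0`)
  obtain ⟨g, hgd, hg_real⟩ := CTS.exists_holo_inner_transfer h χ ψF
  -- Step 3: identity theorem on the right half-plane
  have hU : IsOpen {τ : ℂ | 0 < τ.re} := isOpen_lt continuous_const Complex.continuous_re
  have hUc : IsPreconnected {τ : ℂ | 0 < τ.re} := (convex_halfSpace_re_gt 0).isPreconnected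
  have hga : AnalyticOnNhd ℂ g {τ : ℂ | 0 < τ.re} := hgd.analyticOnNhd hU
  set c : ℝ := max D 0 + 1 with hc
  have hc0 : 0 < c := by rw [hc]; positivity
  have hz₀ : ((c : ℝ) : ℂ) ∈ {τ : ℂ | 0 < τ.re} := by simpa using hc0
  have hfreq : ∃ᶠ z in 𝓝[≠] ((c : ℝ) : ℂ), g z = 0 := by
    set u : ℕ → ℂ := fun n => (((c + 1 / ((n : ℝ) + 1) : ℝ)) : ℂ) with hu
    have hut : Tendsto u atTop (𝓝[≠] ((c : ℝ) : ℂ)) := by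
      rw [tendsto_nhdsWithin_iff]
      refine ⟨?_, Eventually.of_forall fun n => ?_⟩
      · have h1 : Tendsto (fun n : ℕ => c + 1 / ((n : ℝ) + 1)) atTop (𝓝 (c + 0)) :=
          (tendsto_const_nhds (x := c) (f := (atTop : Filter ℕ))).add tendsto_one_div_add_atTop_nhds_zero_nat
        rw [add_zero] at h1
        exact (Complex.continuous_ofReal.tendsto c).comp h1
      · simp only [hu, Set.mem_compl_iff, Set.mem_singleton_iff, Complex.ofReal_inj]
        have : 0 < 1 / ((n : ℝ) + 1) := by positivity
        linarith
    have hall : ∀ n, g (u n) = 0 := by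
      intro n
      have hpos : 0 < c + 1 / ((n : ℝ) + 1) := by positivity
      have hgt : max D 0 < c + 1 / ((n : ℝ) + 1) := by
        have : 0 < 1 / ((n : ℝ) + 1) := by positivity
        rw [hc]; linarith
      simp only [hu]
      rw [hg_real _ hpos]
      exact step1 _ hgt
    exact hut.frequently (Frequently.of_forall hall)
  have hzero : EqOn g 0 {τ : ℂ | 0 < τ.re} :=
    hga.eqOn_zero_of_preconnected_of_frequently_eq_zero hUc hz₀ hfreq
  -- Step 4: all positive times
  have step4 : ∀ x : ℝ, 0 < x → ⟪χ, h.transfer x ψF⟫_ℂ = 0 := by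
    intro x hx
    rw [← hg_real x hx]
    exact hzero (by simpa using hx)
  -- Step 5: strong continuity at `0`
  have hcont : Continuous fun t : ℝ => ⟪χ, h.transfer t ψF⟫_ℂ :=
    (continuous_const : Continuous fun _ : ℝ => χ).inner (h.continuous_transfer_apply ψF)
  have hlim : Tendsto (fun t : ℝ => ⟪χ, h.transfer t ψF⟫_ℂ) (𝓝[>] 0) (𝓝 ⟪χ, h.transfer 0 ψF⟫_ℂ) :=
    (hcont.tendsto 0).mono_left nhdsWithin_le_nhds
  have hlim0 : Tendsto (fun t : ℝ => ⟪χ, h.transfer t ψF⟫_ℂ) (𝓝[>] 0) (𝓝 0) := by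
    refine tendsto_const_nhds.congr' ?_
    filter_upwards [self_mem_nhdsWithin] with t ht
    exact (step4 t ht).symm
  have heq := tendsto_nhds_unique hlim hlim0
  rwa [h.transfer_zero, ContinuousLinearMap.id_apply] at heq

end DrefuteG2
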